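import Summits.KontsevichZagierPeriods.KontsevichZagierPeriods.Theorems.BetaCancellation.Negative.LoadBearing
import Literature.NumberTheory.Transcendental.KZProductIdeal
import Literature.NumberTheory.Transcendental.KZRelationsLE
import Literature.NumberTheory.Transcendental.KZLogCalculusProofs
import Literature.NumberTheory.Transcendental.KZDominatedFamilyRelations
import Literature.NumberTheory.Transcendental.KZSemialgebraicComplex

/-!
# Euler reflection inside the calculus — interval bookkeeping (lead's glue, part 1)

One-dimensional representations `[(u,v), f]` with algebraic end points, their subdivision at
finitely many algebraic points (domain additivity), `n`-ary integrand additivity, and integer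
multiples. Used by the assembly of `EulerReflectionRational` (item stmt-3383) in the line
`dirichlet-companion-to-pi` of crux stmt-KontsevichZagierPeriods-13633.
-/

noncomputable section

-- `Summit.KontsevichZagierPeriods.KontsevichZagierPeriods.…` is the tree's mandated layout (single-conjunct summit).
set_option linter.dupNamespace false

namespace Summit.KontsevichZagierPeriods.KontsevichZagierPeriods.BetaCancellationLine

open MeasureTheory Set
open Literature.NumberTheory.Transcendental
open Literature.NumberTheory.Transcendental.KZ
open Literature.ModelTheory.ExponentialFields (IsSemialgebraic isSemialgebraic_univ)
open MvPolynomial (aeval X C)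
open Summit.KontsevichZagierPeriods.KontsevichZagierPeriods.BetaCancellationNegative

/-! ## Intervals of `ℝ¹` with algebraic end points -/

/-- The open interval `(u,v) ⊆ ℝ¹`. [folklore] -/
def Ioo1 (u v : ℝ) : Set (Fin 1 → ℝ) := {x | x 0 ∈ Set.Ioo u v}

/-- Membership in `Ioo1`. [folklore] -/
@[simp] theorem mem_Ioo1 {u v : ℝ} {x : Fin 1 → ℝ} : x ∈ Ioo1 u v ↔ x 0 ∈ Set.Ioo u v := Iff.rfl

/-- `{x | c < x i}` is `ℚ`-semialgebraic for algebraic `c`. [folklore] -/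
private theorem isSemialgebraic_setOf_const_lt {n : ℕ} {c : ℝ} (hc : IsAlgebraic ℚ c) (i : Fin n) :
    IsSemialgebraic ℚ {x : Fin n → ℝ | c < x i} := by
  have hf : IsSemialgebraicFunOn ℚ (univ : Set (Fin n → ℝ)) (fun x => c - x i) :=
    IsSemialgebraicFunOn.sub_holds (isSemialgebraicFunOn_const_of_isAlgebraic isSemialgebraic_univ hc)
      ((isSemialgebraicFunOn_aeval isSemialgebraic_univ (X i)).congr fun x _ => by simp)
  convert hf.isSemialgebraic_sep_neg using 1
  ext x
  simp [sub_neg]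

/-- `{x | x i < c}` is `ℚ`-semialgebraic for algebraic `c`. [folklore] -/
private theorem isSemialgebraic_setOf_lt_const {n : ℕ} {c : ℝ} (hc : IsAlgebraic ℚ c) (i : Fin n) :
    IsSemialgebraic ℚ {x : Fin n → ℝ | x i < c} := by
  have hf : IsSemialgebraicFunOn ℚ (univ : Set (Fin n → ℝ)) (fun x => x i - c) :=
    IsSemialgebraicFunOn.sub_holds
      ((isSemialgebraicFunOn_aeval isSemialgebraic_univ (X i)).congr fun x _ => by simp)
      (isSemialgebraicFunOn_const_of_isAlgebraic isSemialgebraic_univ hc)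
  convert hf.isSemialgebraic_sep_neg using 1
  ext x
  simp [sub_neg]

/-- `{x | x i ≤ c}` is `ℚ`-semialgebraic for algebraic `c`. [folklore] -/
theorem isSemialgebraic_setOf_le_const {n : ℕ} {c : ℝ} (hc : IsAlgebraic ℚ c) (i : Fin n) :
    IsSemialgebraic ℚ {x : Fin n → ℝ | x i ≤ c} := by
  have h : {x : Fin n → ℝ | x i ≤ c} = {x : Fin n → ℝ | c < x i}ᶜ := by
    ext x; simp [not_lt]
  rw [h]
  exact (isSemialgebraic_setOf_const_lt hc i).compl

/-- `{x | c ≤ x i}` is `ℚ`-semialgebraic for algebraic `c`. [folklore] -/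
theorem isSemialgebraic_setOf_const_le {n : ℕ} {c : ℝ} (hc : IsAlgebraic ℚ c) (i : Fin n) :
    IsSemialgebraic ℚ {x : Fin n → ℝ | c ≤ x i} := by
  have h : {x : Fin n → ℝ | c ≤ x i} = {x : Fin n → ℝ | x i < c}ᶜ := by
    ext x; simp [not_lt]
  rw [h]
  exact (isSemialgebraic_setOf_lt_const hc i).compl

/-- `(u,v) ⊆ ℝ¹` is `ℚ`-semialgebraic for algebraic `u, v`. [folklore] -/
theorem isSemialgebraic_Ioo1 {u v : ℝ} (hu : IsAlgebraic ℚ u) (hv : IsAlgebraic ℚ v) :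
    IsSemialgebraic ℚ (Ioo1 u v) := by
  have h : Ioo1 u v = {x : Fin 1 → ℝ | u < x 0} ∩ {x | x 0 < v} := by
    ext x; simp [Ioo1]
  rw [h]
  exact (isSemialgebraic_setOf_const_lt hu 0).inter (isSemialgebraic_setOf_lt_const hv 0)

/-- `(u,v] ⊆ ℝ¹` is `ℚ`-semialgebraic for algebraic `u, v`. [folklore] -/
theorem isSemialgebraic_Ioc1 {u v : ℝ} (hu : IsAlgebraic ℚ u) (hv : IsAlgebraic ℚ v) :
    IsSemialgebraic ℚ {x : Fin 1 → ℝ | x 0 ∈ Set.Ioc u v} := by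
  have h : {x : Fin 1 → ℝ | x 0 ∈ Set.Ioc u v} = {x : Fin 1 → ℝ | u < x 0} ∩ {x | x 0 ≤ v} := by
    ext x; simp
  rw [h]
  exact (isSemialgebraic_setOf_const_lt hu 0).inter (isSemialgebraic_setOf_le_const hv 0)

/-- `[u,v) ⊆ ℝ¹` is `ℚ`-semialgebraic for algebraic `u, v`. [folklore] -/
theorem isSemialgebraic_Ico1 {u v : ℝ} (hu : IsAlgebraic ℚ u) (hv : IsAlgebraic ℚ v) :
    IsSemialgebraic ℚ {x : Fin 1 → ℝ | x 0 ∈ Set.Ico u v} := by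
  have h : {x : Fin 1 → ℝ | x 0 ∈ Set.Ico u v} = {x : Fin 1 → ℝ | u ≤ x 0} ∩ {x | x 0 < v} := by
    ext x; simp
  rw [h]
  exact (isSemialgebraic_setOf_const_le hu 0).inter (isSemialgebraic_setOf_lt_const hv 0)

/-- **Interval representation** `[(u,v), f]` on `ℝ¹`: algebraic end points, an integrand
`x ↦ f (x 0)` which is `ℚ`-semialgebraic on the interval and absolutely integrable on `(u,v)`.
[folklore] -/
def intervalRep (u v : ℝ) (hu : IsAlgebraic ℚ u) (hv : IsAlgebraic ℚ v) (f : ℝ → ℝ)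
    (hf : IsSemialgebraicFunOn ℚ (Ioo1 u v) (fun x => f (x 0)))
    (hint : IntegrableOn f (Set.Ioo u v)) : IntegralRep 1 where
  domain := Ioo1 u v
  integrand := fun x => f (x 0)
  isSemialgebraic_domain := isSemialgebraic_Ioo1 hu hv
  isSemialgebraicFunOn_integrand := hf
  integrableOn := integrableOn_comp_apply_zero_iff.2 hint

/-- The domain of an interval representation. [folklore] -/
@[simp] theorem intervalRep_domain (u v : ℝ) (hu : IsAlgebraic ℚ u) (hv : IsAlgebraic ℚ v)
    (f : ℝ → ℝ) (hf : IsSemialgebraicFunOn ℚ (Ioo1 u v) (fun x => f (x 0)))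
    (hint : IntegrableOn f (Set.Ioo u v)) : (intervalRep u v hu hv f hf hint).domain = Ioo1 u v := rfl

/-- The integrand of an interval representation. [folklore] -/
@[simp] theorem intervalRep_integrand (u v : ℝ) (hu : IsAlgebraic ℚ u) (hv : IsAlgebraic ℚ v)
    (f : ℝ → ℝ) (hf : IsSemialgebraicFunOn ℚ (Ioo1 u v) (fun x => f (x 0)))
    (hint : IntegrableOn f (Set.Ioo u v)) :
    (intervalRep u v hu hv f hf hint).integrand = fun x => f (x 0) := rfl

/-! ## Subdivision of an interval representation (domain additivity) -/

/-- Splitting `[(w₀, b), f]` at an interior algebraic point `a`: the two pieces `(w₀,a)`, `(a,b)`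
(the point `a` is null). [cite: KontsevichZagier2001, §1.2] -/
theorem of_restrict_sub_of_restrict_sub_of_restrict_mem (A : IntegralRep 1) {w₀ a b : ℝ}
    (hw₀ : IsAlgebraic ℚ w₀) (ha : IsAlgebraic ℚ a) (hb : IsAlgebraic ℚ b)
    (h₁ : w₀ < a) (h₂ : a ≤ b) (hsub : Ioo1 w₀ b ⊆ A.domain) :
    of (A.restrict (Ioo1 w₀ b) (isSemialgebraic_Ioo1 hw₀ hb) hsub) -
      of (A.restrict (Ioo1 w₀ a) (isSemialgebraic_Ioo1 hw₀ ha)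
        (fun _ hx => hsub ⟨hx.1, lt_of_lt_of_le hx.2 h₂⟩)) -
      of (A.restrict (Ioo1 a b) (isSemialgebraic_Ioo1 ha hb)
        (fun _ hx => hsub ⟨lt_trans h₁ hx.1, hx.2⟩)) ∈ relations := by
  -- the half-open piece `[a, b)`
  have hIco : {x : Fin 1 → ℝ | x 0 ∈ Set.Ico a b} ⊆ A.domain :=
    fun x hx => hsub ⟨lt_of_lt_of_le h₁ hx.1, hx.2⟩
  set P₂ := A.restrict {x : Fin 1 → ℝ | x 0 ∈ Set.Ico a b} (isSemialgebraic_Ico1 ha hb) hIco with hP₂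
  have h1 : of (A.restrict (Ioo1 w₀ b) (isSemialgebraic_Ioo1 hw₀ hb) hsub) -
      of (A.restrict (Ioo1 w₀ a) (isSemialgebraic_Ioo1 hw₀ ha)
        (fun x hx => hsub ⟨hx.1, lt_of_lt_of_le hx.2 h₂⟩)) - of P₂ ∈ relations := by
    refine domainAddRel_subset_relations
      ⟨1, A.restrict (Ioo1 w₀ b) (isSemialgebraic_Ioo1 hw₀ hb) hsub,
        A.restrict (Ioo1 w₀ a) (isSemialgebraic_Ioo1 hw₀ ha) (fun x hx => hsub ⟨hx.1, lt_of_lt_of_le hx.2 h₂⟩),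
        P₂, ?_, ?_, fun _ _ => rfl, fun _ _ => rfl, rfl⟩
    · ext x
      simp only [IntegralRep.domain_restrict, mem_Ioo1, mem_Ioo, hP₂, mem_union, mem_setOf_eq, mem_Ico]
      constructor
      · rintro ⟨hl, hr⟩
        by_cases hxa : x 0 < a
        · exact Or.inl ⟨hl, hxa⟩
        · exact Or.inr ⟨not_lt.1 hxa, hr⟩
      · rintro (⟨hl, hr⟩ | ⟨hl, hr⟩)
        · exact ⟨hl, lt_of_lt_of_le hr h₂⟩
        · exact ⟨lt_of_lt_of_le h₁ hl, hr⟩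
    · refine measure_mono_null (fun x hx => ?_) (measure_empty (α := Fin 1 → ℝ))
      simp only [IntegralRep.domain_restrict, mem_inter_iff, mem_Ioo1, mem_Ioo, hP₂, mem_setOf_eq,
        mem_Ico] at hx
      exact (lt_irrefl _ (lt_of_lt_of_le hx.1.2 hx.2.1)).elim
  -- drop the end point `a` from `[a,b)`
  have hIoosub : Ioo1 a b ⊆ P₂.domain := fun x hx => ⟨hx.1.le, hx.2⟩
  have h2 : of P₂ - of (P₂.restrict (Ioo1 a b) (isSemialgebraic_Ioo1 ha hb) hIoosub) ∈ relations := by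
    refine P₂.of_sub_of_restrict_mem_relations (isSemialgebraic_Ioo1 ha hb) hIoosub ?_
    refine measure_mono_null (fun x hx => ?_) (volume_setOf_apply_eq_zero 0 a)
    simp only [mem_sdiff, hP₂, IntegralRep.domain_restrict, mem_setOf_eq, mem_Ico, mem_Ioo1, mem_Ioo,
      not_and, not_lt] at hx
    obtain ⟨⟨hl, hr⟩, hno⟩ := hx
    rcases hl.lt_or_eq with hlt | heq
    · exact absurd hr (not_lt.2 (hno hlt))
    · exact heq.symm
  have h3 : P₂.restrict (Ioo1 a b) (isSemialgebraic_Ioo1 ha hb) hIoosub =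
      A.restrict (Ioo1 a b) (isSemialgebraic_Ioo1 ha hb) (fun x hx => hsub ⟨lt_trans h₁ hx.1, hx.2⟩) :=
    IntegralRep.ext' rfl rfl
  rw [h3] at h2
  have := relations.add_mem h1 h2
  convert this using 1
  abel


/-- Chains of strict inequalities. [folklore] -/
theorem lt_of_forall_lt_succ {w : ℕ → ℝ} {M : ℕ} (h : ∀ i < M, w i < w (i + 1)) {i j : ℕ}
    (hij : i < j) (hjM : j ≤ M) : w i < w j := by
  induction j with
  | zero => exact absurd hij (Nat.not_lt_zero _)
  | succ j ih =>
    rcases Nat.lt_succ_iff.1 hij |>.lt_or_eq with hlt | rfl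
    · exact lt_trans (ih hlt (Nat.le_of_succ_le hjM)) (h j (Nat.lt_of_succ_le hjM))
    · exact h i (Nat.lt_of_succ_le hjM)

/-- **Subdivision of an interval representation**: if `A = [(w₀, w_N), f]` and `piece i` is a
representation on `(w_i, w_{i+1})` whose integrand agrees with `f` there (`w₀ < w₁ < ⋯ < w_N`
algebraic), then `[A] − Σ_{i<N} [piece i] ∈ relations` (iterated domain additivity; the division
points are null). [cite: KontsevichZagier2001, §1.2] -/
theorem of_sub_sum_pieces_mem_relations_aux (N : ℕ) (w : ℕ → ℝ) (hw : ∀ i ≤ N, IsAlgebraic ℚ (w i))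
    (hlt : ∀ i < N, w i < w (i + 1)) (A : IntegralRep 1) (hA : A.domain = Ioo1 (w 0) (w N))
    (piece : ℕ → IntegralRep 1) (hpd : ∀ i < N, (piece i).domain = Ioo1 (w i) (w (i + 1)))
    (hpi : ∀ i < N, Set.EqOn (piece i).integrand A.integrand (piece i).domain) :
    of A - ∑ i ∈ Finset.range N, of (piece i) ∈ relations := by
  induction N generalizing A with
  | zero =>
    have hvol : volume A.domain = 0 := by
      rw [hA]
      refine measure_mono_null (fun x hx => ?_) (measure_empty (α := Fin 1 → ℝ))
      simp only [mem_Ioo1, mem_Ioo] at hx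
      exact (lt_irrefl _ (lt_trans hx.1 hx.2)).elim
    simpa using of_mem_relations_of_volume_eq_zero A hvol
  | succ N ih =>
    rcases Nat.eq_zero_or_pos N with rfl | hN
    · -- one piece
      simp only [zero_add, Finset.range_one, Finset.sum_singleton]
      refine of_sub_of_mem_relations_of_eqOn (by rw [hpd 0 (by norm_num), hA]) fun x hx => ?_
      have hx' : x ∈ (piece 0).domain := by rw [hpd 0 (by norm_num)]; rw [hA] at hx; exact hx
      exact (hpi 0 (by norm_num) hx').symm
    · have h0N : w 0 < w N := lt_of_forall_lt_succ hlt hN le_self_add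
      have hNN : w N ≤ w (N + 1) := (hlt N (Nat.lt_succ_self N)).le
      have hsub : Ioo1 (w 0) (w (N + 1)) ⊆ A.domain := by rw [hA]
      -- `A` versus its restriction to its own domain
      have hfull : of A - of (A.restrict (Ioo1 (w 0) (w (N + 1)))
          (isSemialgebraic_Ioo1 (hw 0 (Nat.zero_le _)) (hw (N + 1) le_rfl)) hsub) ∈ relations :=
        of_sub_of_mem_relations_of_eqOn (by simp [hA]) fun _ _ => rfl
      have hsplit := of_restrict_sub_of_restrict_sub_of_restrict_mem A (hw 0 (Nat.zero_le _))
        (hw N (Nat.le_succ N)) (hw (N + 1) le_rfl) h0N hNN hsub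
      -- induction hypothesis on the left part
      set A₁ := A.restrict (Ioo1 (w 0) (w N)) (isSemialgebraic_Ioo1 (hw 0 (Nat.zero_le _))
        (hw N (Nat.le_succ N))) (fun _ hx => hsub ⟨hx.1, lt_of_lt_of_le hx.2 hNN⟩) with hA₁
      have hih := ih (fun i hi => hw i (Nat.le_succ_of_le hi)) (fun i hi => hlt i (Nat.lt_succ_of_lt hi))
        A₁ rfl (fun i hi => hpd i (Nat.lt_succ_of_lt hi)) (fun i hi => hpi i (Nat.lt_succ_of_lt hi))
      -- the last piece
      set A₂ := A.restrict (Ioo1 (w N) (w (N + 1))) (isSemialgebraic_Ioo1 (hw N (Nat.le_succ N))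
        (hw (N + 1) le_rfl)) (fun _ hx => hsub ⟨lt_trans h0N hx.1, hx.2⟩) with hA₂
      have hlast : of A₂ - of (piece N) ∈ relations := by
        refine of_sub_of_mem_relations_of_eqOn (by rw [hpd N (Nat.lt_succ_self N)]; rfl) fun x hx => ?_
        have hx' : x ∈ (piece N).domain := by rw [hpd N (Nat.lt_succ_self N)]; exact hx
        exact (hpi N (Nat.lt_succ_self N) hx').symm
      rw [Finset.sum_range_succ]
      have := relations.add_mem (relations.add_mem (relations.add_mem hfull hsplit) hih) hlast
      convert this using 1
      simp only [hA₁, hA₂]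
      abel

/-- **Subdivision of an interval representation** (registered form): `[A] − Σ_{i<N} [piece i] ∈
relations` for `A = [(w₀,w_N), f]` and pieces on `(w_i, w_{i+1})` agreeing with `f`.
[cite: KontsevichZagier2001, §1.2] -/
theorem of_sub_sum_pieces_mem_relations : ∀ (N : ℕ) (w : ℕ → ℝ), (∀ i ≤ N, IsAlgebraic ℚ (w i)) → (∀ i < N, w i < w (i + 1)) → ∀ (A : Literature.NumberTheory.Transcendental.KZ.IntegralRep 1), A.domain = Summit.KontsevichZagierPeriods.KontsevichZagierPeriods.BetaCancellationLine.Ioo1 (w 0) (w N) → ∀ (piece : ℕ → Literature.NumberTheory.Transcendental.KZ.IntegralRep 1), (∀ i < N, (piece i).domain = Summit.KontsevichZagierPeriods.KontsevichZagierPeriods.BetaCancellationLine.Ioo1 (w i) (w (i + 1))) → (∀ i < N, Set.EqOn (piece i).integrand A.integrand (piece i).domain) → Literature.NumberTheory.Transcendental.KZ.of A - ∑ i ∈ Finset.range N, Literature.NumberTheory.Transcendental.KZ.of (piece i) ∈ Literature.NumberTheory.Transcendental.KZ.relations :=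
  fun N w hw hlt A hA piece hpd hpi => of_sub_sum_pieces_mem_relations_aux N w hw hlt A hA piece hpd hpi

/-! ## `n`-ary integrand additivity and integer multiples -/

/-- **`n`-ary integrand additivity**: if `R` and the `T i` (`i ∈ s`) share a domain on which
`R.integrand = Σ_i (T i).integrand`, then `[R] − Σ_i [T i] ∈ relations`.
[cite: KontsevichZagier2001, §1.2] -/
theorem of_sub_sum_of_mem_relations {n : ℕ} {ι : Type*} (s : Finset ι) (R : IntegralRep n)
    (T : ι → IntegralRep n) (hd : ∀ i ∈ s, (T i).domain = R.domain)
    (hsum : Set.EqOn R.integrand (fun x => ∑ i ∈ s, (T i).integrand x) R.domain) :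
    of R - ∑ i ∈ s, of (T i) ∈ relations := by
  classical
  induction s using Finset.induction_on generalizing R with
  | empty =>
    simp only [Finset.sum_empty, sub_zero]
    exact of_mem_relations_of_eqOn_zero R fun x hx => by simpa using hsum hx
  | insert a s ha ih =>
    -- the partial-sum representation on `R.domain`
    have hT : ∀ i ∈ s, IsSemialgebraicFunOn ℚ R.domain (T i).integrand := fun i hi => by
      rw [← hd i (Finset.mem_insert_of_mem hi)]; exact (T i).isSemialgebraicFunOn_integrand
    have hTi : ∀ i ∈ s, IntegrableOn (T i).integrand R.domain := fun i hi => by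
      rw [← hd i (Finset.mem_insert_of_mem hi)]; exact (T i).integrableOn
    let R' : IntegralRep n :=
      { domain := R.domain
        integrand := fun x => ∑ i ∈ s, (T i).integrand x
        isSemialgebraic_domain := R.isSemialgebraic_domain
        isSemialgebraicFunOn_integrand := KZ.isSemialgebraicFunOn_finset_sum s R.isSemialgebraic_domain hT
        integrableOn := integrable_finsetSum s hTi }
    have h1 : of R - of (T a) - of R' ∈ relations := by
      refine integrandAddRel_subset_relations ⟨n, R, T a, R', hd a (Finset.mem_insert_self a s), rfl,
        fun x hx => ?_, rfl⟩
      rw [hsum hx]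
      show (∑ i ∈ insert a s, (T i).integrand x) = (T a).integrand x + ∑ i ∈ s, (T i).integrand x
      rw [Finset.sum_insert ha]
    have h2 := ih R' (fun i hi => hd i (Finset.mem_insert_of_mem hi)) (fun _ _ => rfl)
    rw [Finset.sum_insert ha]
    have := relations.add_mem h1 h2
    convert this using 1
    abel

/-- **Integer multiples**: `[σ, N·f] − N·[σ, f] ∈ relations` (integrand additivity, `N` times).
[cite: KontsevichZagier2001, §1.2] -/
theorem of_constMul_nat_sub_nsmul_mem {n : ℕ} (Z : IntegralRep n) (N : ℕ) :
    of (Z.constMul (N : ℝ) (isAlgebraic_nat N)) - N • of Z ∈ relations := by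
  induction N with
  | zero =>
    simp only [zero_smul, sub_zero]
    exact of_mem_relations_of_eqOn_zero _ fun x _ => by simp
  | succ N ih =>
    have h1 : of (Z.constMul ((N + 1 : ℕ) : ℝ) (isAlgebraic_nat (N + 1))) - of Z -
        of (Z.constMul (N : ℝ) (isAlgebraic_nat N)) ∈ relations := by
      refine integrandAddRel_subset_relations
        ⟨n, Z.constMul ((N + 1 : ℕ) : ℝ) (isAlgebraic_nat (N + 1)), Z,
          Z.constMul (N : ℝ) (isAlgebraic_nat N), rfl, rfl, fun x _ => ?_, rfl⟩
      simp only [IntegralRep.integrand_constMul, Pi.add_apply, Nat.cast_succ]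
      ring
    rw [succ_nsmul]
    have := relations.add_mem h1 ih
    convert this using 1
    abel

end Summit.KontsevichZagierPeriods.KontsevichZagierPeriods.BetaCancellationLine
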